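import Literature.NumberTheory.Automorphic.TDGroupTestFunctions
import Literature.NumberTheory.Automorphic.GLnGelfandKazhdanInvolution
import HarnessLib

/-!
# The Gelfand–Kazhdan criterion for `GL_n(F)`: uniqueness of Whittaker functionals from the two
Gelfand–Kazhdan distribution theorems

Topic `NumberTheory/Automorphic`; a *proofs* file next to `WhittakerModels` towards the named fact
`Literature.NumberTheory.Automorphic.rank_whittakerFunctionals_le_one` (local multiplicity one,
`dim Hom_{U_n}(π, ψ_U) ≤ 1` for an irreducible smooth representation `π` of `GL_n(F)`;
Gelfand–Kazhdan 1975; Shalika 1974, Thm. 3.1; announced as Gelfand–Kazhdan 1972, Thm. 3, for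
irreducible *admissible* `π`). Definitions with bodies and proved theorems only; no new named fact.

## What is proved

Gelfand–Kazhdan's theorem is, in Bump's exposition (*Automorphic Forms and Representations*
(1997), §4.4), the conjunction of two results on invariant distributions on `GL_n(F)` and a
deduction:

* (A) **Bump, Theorem 4.4.2** (p. 455; Gelfand–Kazhdan): a distribution `Δ` with
  `λ(u) Δ = ψ_N(u)⁻¹ Δ` and `ρ(u) Δ = ψ_N(u) Δ` for `u ∈ N(F)` ((4.1), conventions (3.4)–(3.5) of
  p. 435, i.e. `Δ(λ(u) φ) = ψ_N(u) Δ(φ)` and `Δ(ρ(u) φ) = ψ_N(u)⁻¹ Δ(φ)`) is stable under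
  `ι(g) = w⁰ ᵗg w⁰`;
* (B) **Gelfand–Kazhdan 1972, Theorem 1 = Bump, Theorem 4.2.2 (i)** (p. 432): an irreducible
  admissible `(π, V)` carries a non-singular bilinear form with `B(π(g) ξ, π(ᵗg⁻¹) η) = B(ξ, η)`
  (equivalently `π̂ ≅ π₁`, `π₁(g) = π(ᵗg⁻¹)`);
* the deduction "(A) + (B) ⇒ Theorem 4.4.1" (uniqueness of Whittaker functionals for irreducible
  admissible `π`), Bump pp. 457–459, (4.7)–(4.18) with Lemma 4.4.1 — *the Gelfand–Kazhdan
  criterion*.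

This file proves the deduction, for all `n`, as
`rank_whittakerFunctionals_le_one_of_gelfandKazhdan`: for irreducible admissible `π`, hypotheses
(A) (for the given `ψ`) and (B) (for the given `π`, with non-degeneracy only required in the second
variable) imply `Module.rank ℂ (whittakerFunctionals π ψ) ≤ 1`. The corollary
`rank_whittakerFunctionals_le_one_of_gelfandKazhdan_of_jacquet` records that, together with
Jacquet's admissibility theorem in the form `JacquetAdmissibilityStatement (GL (Fin n) F)` (the
content of the named fact `jacquetAdmissibility_gl`; Bernstein–Zelevinsky 1976, 3.25), they give the
named fact `rank_whittakerFunctionals_le_one π ψ` itself (for `V` in the universe of `F`). Bump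
proves (A) and (B) only for `n = 2` (pp. 450, 456–457); for general `n` they are Gelfand–Kazhdan's
theorems (Bernstein–Zelevinsky 1976, §7), not yet in the tree — they are the two remaining inputs,
stated here exactly as the hypotheses `hA`, `hB`.

## The proof (Bump 1997, pp. 457–459) and its formalisation

* (4.7)–(4.8): from `B` the pairing `⟨ξ, η⟩ = B(ξ, π(w⁰) η)` with `⟨π(g) ξ, η⟩ = ⟨ξ, π(ι g) η⟩`
  (`gkPairing`, `gkPairing_apply_apply`); `j : η ↦ ⟨·, η⟩` is injective with smooth values and
  `G`-stable range, hence — the contragredient of an irreducible admissible representation being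
  irreducible (`Representation.isIrreducible_contragredient_holds`) — a linear isomorphism
  `V ≃ Ṽ` (`gkDualEquiv`); Bump's `[L]` is `gkDualEquiv.symm L`. This is the only use of
  admissibility.
* (4.9)–(4.12): `Λ ⋆ φ` and its properties are in `TDGroupTestFunctions`; `[Λ ⋆ φ]` is
  `gkVector … Λ φ`, with (4.10) `π(g) [Λ ⋆ φ] = [Λ ⋆ ρ(ι g⁻¹) φ]` (`apply_gkVector`) and (4.12)
  (`gkVector_leftTranslate`).
* (4.13): `Δ(φ) = Λ₂([Λ₁ ⋆ φ])` (`gkDistribution`) satisfies (4.1)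
  (`gkDistribution_leftTranslate`, `gkDistribution_rightTranslate`, the latter using
  `ψ_U(ι u) = ψ_U(u)`), so (A) applies.
* Lemma 4.4.1 (`smear_eq_zero_of_smear_eq_zero`): `Λ₁ ⋆ φ = 0 ⇒ Λ₂ ⋆ φ = 0`. Steps (4.14)–(4.16)
  are carried out with finite coset sums (`integral_mul_eq_finset_sum`) in place of the
  convolution `σ ⋆ ιφ`: both `∫ σ(b) Δ(λ(b) ιφ) db` (zero by (4.14)) and `∫ ιφ(c⁻¹) Δ(ρ(c) σ) dc`
  equal `Δ` of one and the same test function, and the latter integral is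
  `(Λ₂ ⋆ φ)([Λ₁ ⋆ σ])` after the change of variables `g ↦ ι(g⁻¹)`, which preserves Haar measure
  (`integral_comp_gkInvolution_inv`; this and the right invariance used in (4.10) rest on the
  unimodularity of `GL_n(F)`, `isMulRightInvariant_generalLinearGroup`).
* (4.17) (`gkVector_surjective`): the `[Λ₁ ⋆ σ]` fill `V` (a `G`-stable subspace, non-zero by the
  bump-function computation `smear_indicator_apply`), for `Λ₁ ≠ 0`.
* (4.18): `T [Λ₁ ⋆ φ] = [Λ₂ ⋆ φ]` is a well-defined intertwining operator, a scalar `c` by Schur's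
  lemma (`Representation.IsAdmissible.exists_eq_smul_id`), and `Λ₂ = c Λ₁` by evaluating on bump
  functions; hence `rank ≤ 1` (`rank_submodule_le_one_iff'`).

## References

* D. Bump, *Automorphic Forms and Representations*, Cambridge Stud. Adv. Math. 55 (1997), §4.4:
  Theorem 4.4.1 and 4.4.2 (p. 455), proof of Theorem 4.4.1 (pp. 457–459, (4.7)–(4.18),
  Lemma 4.4.1); Theorem 4.2.2 (p. 432). Page numbers of the held copy. [Bump1997]
* I. M. Gelfand, D. A. Kazhdan, *Representations of the group GL(n, K) where K is a local field*,
  in: Lie groups and their representations (Budapest 1971), Halsted (1975), 95–118.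
  [GelfandKazhdan1975] Announcement: Funct. Anal. Appl. 6 (1972), 315–317, Theorems 1 and 3
  (= Gelfand, Collected Papers II, pp. 461–463, held). [GelfandKazhdan1972]
* I. N. Bernstein, A. V. Zelevinsky, Russian Math. Surveys 31:3 (1976), 1–68, §§5.16–5.17, §7.
  [BernsteinZelevinskyRMS1976]
* J. A. Shalika, *The multiplicity one theorem for GL_n*, Ann. of Math. 100 (1974), Thm. 3.1.
  [Shalika1974]
-/

open Matrix MeasureTheory MeasureTheory.Measure Topology
open scoped MatrixGroups NNReal ENNReal Pointwise

/-! ### The Gelfand–Kazhdan criterion for Whittaker functionals on `GL_n(F)` -/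

namespace Literature.NumberTheory.Automorphic

section GelfandKazhdanCriterion

open GaloisRepresentations (glTransposeInv coe_glTransposeInv_apply)

variable {F : Type*} [Field F] [TopologicalSpace F] {n : ℕ} {V : Type*} [AddCommGroup V]
  [Module ℂ V] {π : Representation ℂ (GL (Fin n) F) V}

/-! #### The invariant pairing attached to a Gelfand–Kazhdan form (Bump 1997, (4.7)) -/

section Pairing


variable (π) (B : V →ₗ[ℂ] V →ₗ[ℂ] ℂ)

/-- The pairing `⟨ξ, η⟩ = B(ξ, π(w⁰) η)` attached to a bilinear form `B` with
`B(π(g) ξ, π(ᵗg⁻¹) η) = B(ξ, η)`; it satisfies `⟨π(g) ξ, η⟩ = ⟨ξ, π(ι g) η⟩` (Bump 1997, (4.7),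
p. 457: "`π(w⁰)` is an intertwining operator between `π'` and `π₁`"). [cite: Bump1997, (4.7), p. 457] -/
def gkPairing : V →ₗ[ℂ] V →ₗ[ℂ] ℂ :=
  B.compl₂ (π (weylLong n F))

omit [TopologicalSpace F] in
/-- Unfolding lemma for `gkPairing`. [folklore] -/
lemma gkPairing_apply (ξ η : V) : gkPairing π B ξ η = B ξ (π (weylLong n F) η) := rfl

variable {π B}

/-- **Invariance of the pairing** (Bump 1997, (4.7)): `⟨π(g) ξ, η⟩ = ⟨ξ, π(ι g) η⟩`.
[cite: Bump1997, (4.7), p. 457] -/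
lemma gkPairing_apply_apply (hB : ∀ g ξ η, B (π g ξ) (π (glTransposeInv (Fin n) F g) η) = B ξ η)
    (g : GL (Fin n) F) (ξ η : V) :
    gkPairing π B (π g ξ) η = gkPairing π B ξ (π (gkInvolution g) η) := by
  rw [gkPairing_apply, gkPairing_apply]
  have h := hB g ξ (π (glTransposeInv (Fin n) F g)⁻¹ (π (weylLong n F) η))
  rw [← Module.End.mul_apply, ← map_mul, mul_inv_cancel, map_one, Module.End.one_apply] at h
  rw [h, ← Module.End.mul_apply, ← map_mul, ← Module.End.mul_apply, ← map_mul]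
  have hw : (glTransposeInv (Fin n) F g)⁻¹ * weylLong n F = weylLong n F * gkInvolution g := by
    rw [gkInvolution, ← mul_assoc, ← mul_assoc, weylLong_mul_self, one_mul, map_inv]
  rw [hw]

/-- The map `j : η ↦ ⟨·, η⟩` from `V` to linear forms on `V`. [folklore] -/
def gkDualMap (π : Representation ℂ (GL (Fin n) F) V) (B : V →ₗ[ℂ] V →ₗ[ℂ] ℂ) :
    V →ₗ[ℂ] Module.Dual ℂ V :=
  (gkPairing π B).flip

omit [TopologicalSpace F] in
/-- Unfolding lemma for `gkDualMap`: `j(η)(ξ) = ⟨ξ, η⟩`. [folklore] -/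
lemma gkDualMap_apply (η ξ : V) : gkDualMap π B η ξ = gkPairing π B ξ η := rfl

omit [TopologicalSpace F] in
/-- `j` is injective when `B` is non-degenerate on the right. [folklore] -/
lemma gkDualMap_injective (hBnd : ∀ η, (∀ ξ, B ξ η = 0) → η = 0) :
    Function.Injective (gkDualMap π B) := by
  refine (injective_iff_map_eq_zero _).2 fun η hη => ?_
  have h : π (weylLong n F) η = 0 :=
    hBnd _ fun ξ => by simpa [gkDualMap_apply, gkPairing_apply] using LinearMap.congr_fun hη ξ
  calc η = π (weylLong n F * weylLong n F) η := by
          rw [weylLong_mul_self, map_one, Module.End.one_apply]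
    _ = π (weylLong n F) (π (weylLong n F) η) := by rw [map_mul, Module.End.mul_apply]
    _ = 0 := by rw [h, map_zero]

/-- **Equivariance of `j`**: `j(π(g) η) = π^*(ι(g⁻¹)) j(η)`, i.e. `j` intertwines `π` twisted by the
automorphism `g ↦ ι(g⁻¹)` with the dual representation. [cite: Bump1997, (4.7), p. 457] -/
lemma gkDualMap_apply_apply (hB : ∀ g ξ η, B (π g ξ) (π (glTransposeInv (Fin n) F g) η) = B ξ η)
    (g : GL (Fin n) F) (η : V) :
    gkDualMap π B (π g η) = π.dual (gkInvolution g⁻¹) (gkDualMap π B η) := by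
  ext ξ
  rw [gkDualMap_apply, Representation.dual_apply, Module.Dual.transpose_apply,
    LinearMap.comp_apply, gkDualMap_apply, gkPairing_apply_apply hB, ← gkInvolution_inv, inv_inv,
    gkInvolution_gkInvolution]

/-- The dual action on `j(η)` is `j` of a twisted action: `π^*(a) j(η) = j(π(ι(a⁻¹)) η)`, so the
range of `j` is stable under the dual representation. [folklore] -/
lemma dual_gkDualMap (hB : ∀ g ξ η, B (π g ξ) (π (glTransposeInv (Fin n) F g) η) = B ξ η)
    (a : GL (Fin n) F) (η : V) :
    π.dual a (gkDualMap π B η) = gkDualMap π B (π (gkInvolution a⁻¹) η) := by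
  rw [gkDualMap_apply_apply hB, gkInvolution_inv a, inv_inv, gkInvolution_gkInvolution]

end Pairing

variable [ValuativeRel F] [IsNonarchimedeanLocalField F]

attribute [local instance] t2Space_generalLinearGroup locallyCompactSpace_generalLinearGroup
  nonarchimedeanGroup_gl sigmaCompactSpace_generalLinearGroup

/-- The involution `φ ↦ φ ∘ ι` of `C_c^∞(GL_n(F))` induced by the Gelfand–Kazhdan involution
`ι(g) = w⁰ ᵗg w⁰` (Bump 1997, §4.4, p. 455: "`ι` also induces involutions on `C_c^∞(GL(n,F))`
and `𝔇(GL(n,F))`"). [cite: Bump1997, §4.4, p. 455] -/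
def SchwartzBruhat.compGKInvolution :
    SchwartzBruhat (GL (Fin n) F) →ₗ[ℂ] SchwartzBruhat (GL (Fin n) F) where
  toFun φ := ⟨fun g => (φ : GL (Fin n) F → ℂ) (gkInvolution g),
    ⟨φ.2.1.comp_continuous continuous_gkInvolution,
      φ.2.2.comp_homeomorph (gkInvolutionHomeomorph (n := n) (R := F))⟩⟩
  map_add' _ _ := rfl
  map_smul' _ _ := rfl

/-- Unfolding lemma for `SchwartzBruhat.compGKInvolution`. [folklore] -/
@[simp] lemma SchwartzBruhat.compGKInvolution_apply (φ : SchwartzBruhat (GL (Fin n) F))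
    (g : GL (Fin n) F) :
    (SchwartzBruhat.compGKInvolution φ : GL (Fin n) F → ℂ) g = (φ : GL (Fin n) F → ℂ) (gkInvolution g) :=
  rfl

/-- `(ρ(a) φ) ∘ ι = λ(ι(a)⁻¹) (φ ∘ ι)`: the involution exchanges right and left translations.
[folklore] -/
lemma SchwartzBruhat.compGKInvolution_rightTranslate (a : GL (Fin n) F)
    (φ : SchwartzBruhat (GL (Fin n) F)) :
    SchwartzBruhat.compGKInvolution (SchwartzBruhat.rightTranslate a φ) =
      SchwartzBruhat.leftTranslate (gkInvolution a)⁻¹ (SchwartzBruhat.compGKInvolution φ) := by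
  apply Subtype.ext
  funext g
  simp only [SchwartzBruhat.compGKInvolution_apply, SchwartzBruhat.rightTranslate_apply,
    SchwartzBruhat.leftTranslate_apply, inv_inv, gkInvolution_mul, gkInvolution_gkInvolution]

/-- A compact open subgroup of `GL_n(F)` fixing a given smooth vector: `GL_n(𝒪) ∩ Stab(ξ)`.
[folklore] -/
lemma exists_isCompact_isOpen_le_stabilizer (hπ : π.IsSmooth) (ξ : V) :
    ∃ K : Subgroup (GL (Fin n) F), IsOpen (K : Set (GL (Fin n) F)) ∧
      IsCompact (K : Set (GL (Fin n) F)) ∧ ∀ k ∈ K, π k ξ = ξ :=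
  ⟨glInt n F ⊓ π.stabilizerSubgroup ξ, (isOpen_glInt n F).inter (hπ ξ),
    (isCompact_glInt n F).of_isClosed_subset
      (Subgroup.isClosed_of_isOpen _ ((isOpen_glInt n F).inter (hπ ξ))) fun _ hg => hg.1,
    fun k hk => (π.mem_stabilizerSubgroup ξ k).1 hk.2⟩

section Smooth

variable {B : V →ₗ[ℂ] V →ₗ[ℂ] ℂ}

/-- `j(η)` is a smooth linear form when `η` is a smooth vector: its stabiliser contains the
preimage of the stabiliser of `η` under the automorphism `g ↦ ι(g⁻¹)`. [folklore] -/
lemma gkDualMap_mem_contragredient (hB : ∀ g ξ η, B (π g ξ) (π (glTransposeInv (Fin n) F g) η) = B ξ η)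
    (hπ : π.IsSmooth) (η : V) : gkDualMap π B η ∈ π.contragredient := by
  rw [Representation.mem_contragredient]
  set τ : GL (Fin n) F →* GL (Fin n) F := (gkAutomorphism (n := n) (R := F)).toMonoidHom with hτdef
  have hτ : ∀ g, τ g = gkInvolution g⁻¹ := fun g => gkAutomorphism_apply g
  refine π.dual.isSmoothVector_of_le (K := (π.stabilizerSubgroup η).comap τ) ?_ fun g hg => ?_
  · rw [Subgroup.coe_comap]
    exact (hπ η).preimage (gkAutomorphism (n := n) (R := F)).continuous
  · rw [Subgroup.mem_comap, Representation.mem_stabilizerSubgroup] at hg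
    rw [Representation.mem_stabilizerSubgroup]
    have h := gkDualMap_apply_apply hB (τ g) η (π := π) (B := B)
    rw [hg, hτ g, gkInvolution_inv g, inv_inv, gkInvolution_gkInvolution] at h
    exact h.symm

/-- **`j` maps `V` onto the smooth dual** when `π` is irreducible and admissible: the range of
`j` is a non-zero subrepresentation of the contragredient `Ṽ`, which is irreducible
(`Representation.isIrreducible_contragredient_holds`, Bernstein–Zelevinsky 1976, 2.15; Bump 1997,
Exercise 4.2.8). This is where admissibility enters Bump's proof ((4.8), p. 458: "if `Λ` is a
smooth linear functional on `V`, there exists an element `[Λ]` of `V`"). [cite: Bump1997, (4.8), p. 458] -/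
lemma range_gkDualMap_eq (hB : ∀ g ξ η, B (π g ξ) (π (glTransposeInv (Fin n) F g) η) = B ξ η)
    (hBnd : ∀ η, (∀ ξ, B ξ η = 0) → η = 0) [π.IsIrreducible] (hadm : π.IsAdmissible) :
    LinearMap.range (gkDualMap π B) = π.contragredient.toSubmodule := by
  haveI hirr : π.contragredientRep.IsIrreducible :=
    Representation.isIrreducible_contragredient_holds π hadm
  apply le_antisymm
  · rintro _ ⟨η, rfl⟩
    exact gkDualMap_mem_contragredient hB hadm.isSmooth η
  · -- the range, viewed inside `Ṽ`, is a subrepresentation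
    let W : Subrepresentation π.contragredientRep :=
      ⟨(LinearMap.range (gkDualMap π B)).comap (Representation.Contragredient.subtype π),
        fun g f hf => by
          obtain ⟨η, hη⟩ := hf
          refine ⟨π (gkInvolution g⁻¹) η, ?_⟩
          change gkDualMap π B (π (gkInvolution g⁻¹) η) =
            π.dual g (Representation.Contragredient.subtype π f)
          rw [← dual_gkDualMap hB, hη]⟩
    haveI : Nontrivial V := Representation.IsIrreducible.nontrivial π
    obtain ⟨η₀, hη₀⟩ := exists_ne (0 : V)
    set f₀ : π.Contragredient :=
      ⟨gkDualMap π B η₀, gkDualMap_mem_contragredient hB hadm.isSmooth η₀⟩ with hf₀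
    have hW : W ≠ ⊥ := by
      intro h
      have hmem : f₀ ∈ W := ⟨η₀, rfl⟩
      rw [h, Subrepresentation.mem_bot_iff] at hmem
      have h0 : gkDualMap π B η₀ = 0 := congrArg (Representation.Contragredient.subtype π) hmem
      exact hη₀ ((injective_iff_map_eq_zero _).1 (gkDualMap_injective hBnd (π := π)) η₀ h0)
    have hWtop : W = ⊤ := (eq_bot_or_eq_top W).resolve_left hW
    intro f hf
    have : (⟨f, hf⟩ : π.Contragredient) ∈ W := by rw [hWtop]; exact Subrepresentation.mem_top' _
    exact this

/-- **The isomorphism `j : V ≃ Ṽ`** of an irreducible admissible `π` carrying a Gelfand–Kazhdan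
form (so that `Ṽ ≅ π ∘ (g ↦ ι(g⁻¹))`, Bump 1997, Thm. 4.2.2 (i) and (4.7)–(4.8)). [cite: Bump1997, (4.8), p. 458] -/
noncomputable def gkDualEquiv (hB : ∀ g ξ η, B (π g ξ) (π (glTransposeInv (Fin n) F g) η) = B ξ η)
    (hBnd : ∀ η, (∀ ξ, B ξ η = 0) → η = 0) [π.IsIrreducible] (hadm : π.IsAdmissible) :
    V ≃ₗ[ℂ] π.contragredient.toSubmodule :=
  LinearEquiv.ofBijective
    ((gkDualMap π B).codRestrict _ fun η => gkDualMap_mem_contragredient hB hadm.isSmooth η)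
    ⟨fun η η' h => gkDualMap_injective hBnd (congrArg Subtype.val h), fun f => by
      obtain ⟨η, hη⟩ : (f : Module.Dual ℂ V) ∈ LinearMap.range (gkDualMap π B) := by
        rw [range_gkDualMap_eq hB hBnd hadm]; exact f.2
      exact ⟨η, Subtype.ext hη⟩⟩

/-- `gkDualEquiv` is `j` as a function. [folklore] -/
lemma gkDualEquiv_apply (hB : ∀ g ξ η, B (π g ξ) (π (glTransposeInv (Fin n) F g) η) = B ξ η)
    (hBnd : ∀ η, (∀ ξ, B ξ η = 0) → η = 0) [π.IsIrreducible] (hadm : π.IsAdmissible) (η : V) :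
    (gkDualEquiv hB hBnd hadm η : Module.Dual ℂ V) = gkDualMap π B η := rfl

/-- Bump's `[L]` (4.8): the vector with `⟨ξ, [L]⟩ = L(ξ)` for a smooth linear form `L`.
[cite: Bump1997, (4.8), p. 458] -/
lemma gkDualMap_gkDualEquiv_symm (hB : ∀ g ξ η, B (π g ξ) (π (glTransposeInv (Fin n) F g) η) = B ξ η)
    (hBnd : ∀ η, (∀ ξ, B ξ η = 0) → η = 0) [π.IsIrreducible] (hadm : π.IsAdmissible)
    (L : π.contragredient.toSubmodule) :
    gkDualMap π B ((gkDualEquiv hB hBnd hadm).symm L) = L := by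
  rw [← gkDualEquiv_apply hB hBnd hadm, LinearEquiv.apply_symm_apply]

/-- **Bump's (4.10)** in the form `π(g) [L] = [π^*(ι(g⁻¹)... ]`: transporting the dual action
through `[·]`: `π(g) [L] = [π^*(ι g⁻¹)⁻¹ ...]`; precisely `[π^*(a) L] = π(ι(a⁻¹)) [L]`.
[cite: Bump1997, (4.10), p. 458] -/
lemma gkDualEquiv_symm_dual (hB : ∀ g ξ η, B (π g ξ) (π (glTransposeInv (Fin n) F g) η) = B ξ η)
    (hBnd : ∀ η, (∀ ξ, B ξ η = 0) → η = 0) [π.IsIrreducible] (hadm : π.IsAdmissible)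
    (a : GL (Fin n) F) (L : π.contragredient.toSubmodule) :
    (gkDualEquiv hB hBnd hadm).symm ⟨π.dual a L, π.contragredient.apply_mem_toSubmodule a L.2⟩ =
      π (gkInvolution a⁻¹) ((gkDualEquiv hB hBnd hadm).symm L) := by
  apply gkDualMap_injective hBnd (π := π)
  rw [gkDualMap_gkDualEquiv_symm, ← dual_gkDualMap hB, gkDualMap_gkDualEquiv_symm]

end Smooth

/-! #### The distribution `Δ(φ) = Λ₂([Λ₁ ⋆ φ])` and Bump's Lemma 4.4.1 -/

section Distribution

variable [MeasurableSpace (GL (Fin n) F)] [BorelSpace (GL (Fin n) F)] {B : V →ₗ[ℂ] V →ₗ[ℂ] ℂ}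
  (hB : ∀ g ξ η, B (π g ξ) (π (glTransposeInv (Fin n) F g) η) = B ξ η)
  (hBnd : ∀ η, (∀ ξ, B ξ η = 0) → η = 0) [π.IsIrreducible] (hadm : π.IsAdmissible)
  (μ : Measure (GL (Fin n) F)) [IsHaarMeasure μ] [μ.IsMulRightInvariant]

omit [π.IsIrreducible] in
/-- Smeared functionals on `GL_n(F)` are smooth (a compact open right stabiliser of the test
function exists by `exists_isCompact_isOpen_forall_mul_right_eq`). [cite: Bump1997, §4.4, p. 458] -/
lemma smear_mem_contragredient_gl (hπ : π.IsSmooth) (Λ : Module.Dual ℂ V)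
    (φ : SchwartzBruhat (GL (Fin n) F)) : hπ.smear μ Λ φ ∈ π.contragredient := by
  obtain ⟨K, hKo, -, hK⟩ := exists_isCompact_isOpen_forall_mul_right_eq φ.2
  exact hπ.smear_mem_contragredient μ Λ φ hKo hK

/-- **Bump's vector `[Λ ⋆ φ] ∈ V`** ((4.8)–(4.9), p. 458), as a linear map in the test function
`φ`: the smooth form `Λ ⋆ φ` transported to `V` through `j : V ≃ Ṽ`. [cite: Bump1997, (4.9), p. 458] -/
noncomputable def gkVector (Λ : Module.Dual ℂ V) : SchwartzBruhat (GL (Fin n) F) →ₗ[ℂ] V :=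
  (gkDualEquiv hB hBnd hadm).symm.toLinearMap ∘ₗ
    ((hadm.isSmooth.smear μ Λ).codRestrict π.contragredient.toSubmodule
      fun φ => smear_mem_contragredient_gl μ hadm.isSmooth Λ φ)

/-- `j [Λ ⋆ φ] = Λ ⋆ φ`, i.e. `⟨ξ, [Λ ⋆ φ]⟩ = (Λ ⋆ φ)(ξ)` (Bump 1997, (4.8)). [cite: Bump1997, (4.8), p. 458] -/
lemma gkDualMap_gkVector (Λ : Module.Dual ℂ V) (φ : SchwartzBruhat (GL (Fin n) F)) :
    gkDualMap π B (gkVector hB hBnd hadm μ Λ φ) = hadm.isSmooth.smear μ Λ φ := by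
  rw [gkVector, LinearMap.comp_apply, LinearEquiv.coe_toLinearMap, gkDualMap_gkDualEquiv_symm]
  rfl

/-- `[Λ ⋆ φ] = 0 ↔ Λ ⋆ φ = 0`. [folklore] -/
lemma gkVector_eq_zero_iff (Λ : Module.Dual ℂ V) (φ : SchwartzBruhat (GL (Fin n) F)) :
    gkVector hB hBnd hadm μ Λ φ = 0 ↔ hadm.isSmooth.smear μ Λ φ = 0 := by
  rw [← gkDualMap_gkVector hB hBnd hadm μ Λ φ]
  constructor
  · intro h; rw [h, map_zero]
  · intro h
    exact (injective_iff_map_eq_zero _).1 (gkDualMap_injective hBnd (π := π)) _ h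

/-- **Bump's (4.10)**: `π(g) [Λ ⋆ φ] = [Λ ⋆ ρ(ι g⁻¹) φ]`. [cite: Bump1997, (4.10), p. 458] -/
lemma apply_gkVector (Λ : Module.Dual ℂ V) (g : GL (Fin n) F)
    (φ : SchwartzBruhat (GL (Fin n) F)) :
    π g (gkVector hB hBnd hadm μ Λ φ) =
      gkVector hB hBnd hadm μ Λ (SchwartzBruhat.rightTranslate (gkInvolution g⁻¹) φ) := by
  apply gkDualMap_injective hBnd (π := π)
  rw [gkDualMap_apply_apply hB, gkDualMap_gkVector, gkDualMap_gkVector,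
    hadm.isSmooth.dual_smear μ]

variable (ψ : AddChar F Circle)

/-- **Bump's (4.12)**: for a Whittaker functional `Λ`, `[Λ ⋆ λ(u) φ] = ψ_U(u) [Λ ⋆ φ]`.
[cite: Bump1997, (4.12), p. 458] -/
lemma gkVector_leftTranslate {Λ : Module.Dual ℂ V} (hΛ : Λ ∈ whittakerFunctionals π ψ)
    (u : ↥(upperUnitriangular (Fin n) F)) (φ : SchwartzBruhat (GL (Fin n) F)) :
    gkVector hB hBnd hadm μ Λ (SchwartzBruhat.leftTranslate (u : GL (Fin n) F) φ) =
      (whittakerCharFun ψ u : ℂ) • gkVector hB hBnd hadm μ Λ φ := by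
  apply gkDualMap_injective hBnd (π := π)
  rw [map_smul, gkDualMap_gkVector, gkDualMap_gkVector,
    hadm.isSmooth.smear_leftTranslate μ ((mem_whittakerFunctionals_iff Λ).1 hΛ u)]

/-- **The Gelfand–Kazhdan distribution** `Δ(φ) = Λ₂([Λ₁ ⋆ φ])` attached to two linear forms
(Bump 1997, (4.13), p. 458). [cite: Bump1997, (4.13), p. 458] -/
noncomputable def gkDistribution (Λ₁ Λ₂ : Module.Dual ℂ V) :
    Module.Dual ℂ (SchwartzBruhat (GL (Fin n) F)) :=
  Λ₂ ∘ₗ gkVector hB hBnd hadm μ Λ₁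

/-- Unfolding lemma for `gkDistribution`. [cite: Bump1997, (4.13), p. 458] -/
lemma gkDistribution_apply (Λ₁ Λ₂ : Module.Dual ℂ V) (φ : SchwartzBruhat (GL (Fin n) F)) :
    gkDistribution hB hBnd hadm μ Λ₁ Λ₂ φ = Λ₂ (gkVector hB hBnd hadm μ Λ₁ φ) := rfl

/-- `Δ` satisfies the left half of Bump's (4.1): `Δ(λ(u) φ) = ψ_U(u) Δ(φ)` (from (4.12)).
[cite: Bump1997, (4.1), p. 455] -/
lemma gkDistribution_leftTranslate {Λ₁ : Module.Dual ℂ V} (hΛ₁ : Λ₁ ∈ whittakerFunctionals π ψ)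
    (Λ₂ : Module.Dual ℂ V) (u : ↥(upperUnitriangular (Fin n) F))
    (φ : SchwartzBruhat (GL (Fin n) F)) :
    gkDistribution hB hBnd hadm μ Λ₁ Λ₂ (SchwartzBruhat.leftTranslate (u : GL (Fin n) F) φ) =
      whittakerCharFun ψ u * gkDistribution hB hBnd hadm μ Λ₁ Λ₂ φ := by
  rw [gkDistribution_apply, gkDistribution_apply, gkVector_leftTranslate hB hBnd hadm μ ψ hΛ₁,
    map_smul, smul_eq_mul]

/-- `Δ` satisfies the right half of Bump's (4.1): `Δ(ρ(u) φ) = ψ_U(u)⁻¹ Δ(φ)` (from (4.10) and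
`ψ_U(ι u) = ψ_U(u)`). [cite: Bump1997, (4.1), p. 455] -/
lemma gkDistribution_rightTranslate (Λ₁ : Module.Dual ℂ V) {Λ₂ : Module.Dual ℂ V}
    (hΛ₂ : Λ₂ ∈ whittakerFunctionals π ψ) (u : ↥(upperUnitriangular (Fin n) F))
    (φ : SchwartzBruhat (GL (Fin n) F)) :
    gkDistribution hB hBnd hadm μ Λ₁ Λ₂ (SchwartzBruhat.rightTranslate (u : GL (Fin n) F) φ) =
      (whittakerCharFun ψ u)⁻¹ * gkDistribution hB hBnd hadm μ Λ₁ Λ₂ φ := by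
  rw [gkDistribution_apply, gkDistribution_apply]
  have h := apply_gkVector hB hBnd hadm μ Λ₁ (gkInvolution (u : GL (Fin n) F)⁻¹) φ
  rw [← gkInvolution_inv, inv_inv, gkInvolution_gkInvolution] at h
  rw [← h]
  have hmem : gkInvolution (u : GL (Fin n) F)⁻¹ ∈ upperUnitriangular (Fin n) F :=
    gkInvolution_mem_upperUnitriangular ((upperUnitriangular (Fin n) F).inv_mem u.2)
  have h1 : Λ₂ (π (gkInvolution (u : GL (Fin n) F)⁻¹) (gkVector hB hBnd hadm μ Λ₁ φ)) =
      whittakerCharFun ψ ⟨_, hmem⟩ * Λ₂ (gkVector hB hBnd hadm μ Λ₁ φ) :=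
    (mem_whittakerFunctionals_iff Λ₂).1 hΛ₂ ⟨_, hmem⟩ (gkVector hB hBnd hadm μ Λ₁ φ)
  have h2 : whittakerCharFun ψ ⟨_, hmem⟩ = (whittakerCharFun ψ u)⁻¹ := by
    rw [← whittakerCharFun_inv_eq_inv]
    exact whittakerCharFun_gkInvolution ψ u⁻¹
  rw [h1, h2]

/-- **Bump's Lemma 4.4.1** (p. 459): if the Gelfand–Kazhdan distribution `Δ = Λ₂([Λ₁ ⋆ ·])` is
`ι`-stable and the vectors `[Λ₁ ⋆ σ]` exhaust `V`, then `Λ₁ ⋆ φ = 0` implies `Λ₂ ⋆ φ = 0`.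
Printed proof: `Λ₁ ⋆ ρ(g)φ = 0` for all `g` (4.10); by `ι`-stability
`Λ₂([Λ₁ ⋆ λ(g) ιφ]) = 0` for all `g` (4.14); integrating against `σ`,
`Λ₂([Λ₁ ⋆ σ ⋆ ιφ]) = 0` (4.15), i.e. `(Λ₂ ⋆ φ)([Λ₁ ⋆ σ]) = 0` (4.16), and the `[Λ₁ ⋆ σ]` fill `V`
(4.17). Here (4.15)–(4.16) are carried out with the finite coset sums of
`integral_mul_eq_finset_sum` in place of the convolution `σ ⋆ ιφ`. [cite: Bump1997, Lemma 4.4.1, p. 459] -/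
theorem smear_eq_zero_of_smear_eq_zero [μ.Regular] {Λ₁ Λ₂ : Module.Dual ℂ V}
    (hιΔ : ∀ φ, gkDistribution hB hBnd hadm μ Λ₁ Λ₂ (SchwartzBruhat.compGKInvolution φ) =
      gkDistribution hB hBnd hadm μ Λ₁ Λ₂ φ)
    (hsurj : Function.Surjective (gkVector hB hBnd hadm μ Λ₁))
    {φ : SchwartzBruhat (GL (Fin n) F)} (h : hadm.isSmooth.smear μ Λ₁ φ = 0) :
    hadm.isSmooth.smear μ Λ₂ φ = 0 := by
  set D := gkDistribution hB hBnd hadm μ Λ₁ Λ₂ with hD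
  set θ := SchwartzBruhat.compGKInvolution φ with hθ
  -- (4.14): `Δ(λ(b) θ) = 0` for all `b`
  have hb : ∀ b : GL (Fin n) F, D (SchwartzBruhat.leftTranslate b θ) = 0 := by
    intro b
    have hρ : SchwartzBruhat.leftTranslate b θ =
        SchwartzBruhat.compGKInvolution (SchwartzBruhat.rightTranslate (gkInvolution b⁻¹) φ) := by
      rw [SchwartzBruhat.compGKInvolution_rightTranslate, gkInvolution_gkInvolution, inv_inv]
    rw [hρ, hιΔ, gkDistribution_apply,
      (gkVector_eq_zero_iff hB hBnd hadm μ Λ₁ _).2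
        (hadm.isSmooth.smear_rightTranslate_eq_zero μ h _), map_zero]
  -- (4.15): `∫ θ(c⁻¹) Δ(ρ(c) σ) dc = 0` for every test function `σ`
  have hc : ∀ σ : SchwartzBruhat (GL (Fin n) F),
      ∫ c, (θ : GL (Fin n) F → ℂ) c⁻¹ * D (SchwartzBruhat.rightTranslate c σ) ∂μ = 0 := by
    intro σ
    obtain ⟨K, hKo, hKc, hσR, -, -, hθL⟩ := exists_isCompact_isOpen_forall_mul_eq₂ σ.2 θ.2
    have hρK : ∀ k ∈ K, SchwartzBruhat.rightTranslate k σ = σ := fun k hk =>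
      Subtype.ext (funext fun x => hσR k hk x)
    have hlK : ∀ k ∈ K, SchwartzBruhat.leftTranslate k θ = θ := fun k hk =>
      Subtype.ext (funext fun x => by
        rw [SchwartzBruhat.leftTranslate_apply]; exact hθL k⁻¹ (K.inv_mem hk) x)
    -- the two finite coset decompositions
    have hf₁ : (fun c => (θ : GL (Fin n) F → ℂ) c⁻¹) ∈ SchwartzBruhat (GL (Fin n) F) :=
      comp_inv_mem_schwartzBruhat θ.2
    have hf₁K : ∀ k ∈ K, ∀ c, (θ : GL (Fin n) F → ℂ) (c * k)⁻¹ = (θ : GL (Fin n) F → ℂ) c⁻¹ :=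
      fun k hk c => by rw [_root_.mul_inv_rev]; exact hθL k⁻¹ (K.inv_mem hk) _
    obtain ⟨C₁, hC₁⟩ := exists_finset_quotient_of_hasCompactSupport hf₁.2 hKo
    obtain ⟨C₂, hC₂⟩ := exists_finset_quotient_of_hasCompactSupport σ.2.2 hKo
    -- `∫ θ(c⁻¹) Δ(ρ(c) σ) dc = Δ(S₁)`
    have hI : ∫ c, (θ : GL (Fin n) F → ℂ) c⁻¹ * D (SchwartzBruhat.rightTranslate c σ) ∂μ =
        D (∑ q ∈ C₁, ((μ.real (K : Set (GL (Fin n) F)) : ℂ) * (θ : GL (Fin n) F → ℂ) q.out⁻¹) •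
          SchwartzBruhat.rightTranslate q.out σ) := by
      rw [integral_mul_eq_finset_sum μ hKo hKc hf₁K hC₁ (Φ := fun c =>
        D (SchwartzBruhat.rightTranslate c σ)) fun k hk c => by
          simp only [SchwartzBruhat.rightTranslate_mul, hρK k hk]]
      simp only [_root_.map_sum, map_smul, smul_eq_mul, mul_assoc]
    -- `S₁ = S₂` pointwise, where `Δ(S₂) = 0` by (4.14)
    have hS : (∑ q ∈ C₁, ((μ.real (K : Set (GL (Fin n) F)) : ℂ) * (θ : GL (Fin n) F → ℂ) q.out⁻¹) •
          SchwartzBruhat.rightTranslate q.out σ) =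
        ∑ q ∈ C₂, ((μ.real (K : Set (GL (Fin n) F)) : ℂ) * (σ : GL (Fin n) F → ℂ) q.out) •
          SchwartzBruhat.leftTranslate q.out θ := by
      apply Subtype.ext
      funext x
      have h₁ := integral_mul_eq_finset_sum μ hKo hKc hf₁K hC₁
        (Φ := fun c => (σ : GL (Fin n) F → ℂ) (x * c)) fun k hk c => by
          simp only [← mul_assoc, hσR k hk]
      have h₂ := integral_mul_eq_finset_sum μ hKo hKc hσR hC₂
        (Φ := fun b => (θ : GL (Fin n) F → ℂ) (b⁻¹ * x)) fun k hk b => by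
          simp only [_root_.mul_inv_rev, mul_assoc, hθL k⁻¹ (K.inv_mem hk)]
      have h₁₂ : ∫ b, (σ : GL (Fin n) F → ℂ) b * (θ : GL (Fin n) F → ℂ) (b⁻¹ * x) ∂μ =
          ∫ c, (θ : GL (Fin n) F → ℂ) c⁻¹ * (σ : GL (Fin n) F → ℂ) (x * c) ∂μ := by
        rw [← integral_mul_left_eq_self _ x]
        congr 1
        funext c
        rw [_root_.mul_inv_rev, inv_mul_cancel_right, mul_comm]
      simp only [Submodule.coe_sum, Submodule.coe_smul, Finset.sum_apply, Pi.smul_apply,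
        SchwartzBruhat.rightTranslate_apply, SchwartzBruhat.leftTranslate_apply, smul_eq_mul]
      simp only [mul_assoc] at h₁ h₂ ⊢
      rw [← h₁, ← h₁₂, h₂]
    rw [hI, hS, _root_.map_sum]
    refine Finset.sum_eq_zero fun q _ => ?_
    rw [map_smul, hb, smul_zero]
  -- (4.16): `(Λ₂ ⋆ φ)([Λ₁ ⋆ σ]) = 0`
  have hd : ∀ σ : SchwartzBruhat (GL (Fin n) F),
      hadm.isSmooth.smear μ Λ₂ φ (gkVector hB hBnd hadm μ Λ₁ σ) = 0 := by
    intro σ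
    rw [Representation.IsSmooth.smear_apply_apply]
    have heq : (fun g => (φ : GL (Fin n) F → ℂ) g * Λ₂ (π g (gkVector hB hBnd hadm μ Λ₁ σ))) =
        fun g => (fun c => (θ : GL (Fin n) F → ℂ) c⁻¹ * D (SchwartzBruhat.rightTranslate c σ))
          (gkInvolution g⁻¹) := by
      funext g
      simp only [apply_gkVector hB hBnd hadm μ, hD, gkDistribution_apply, hθ,
        SchwartzBruhat.compGKInvolution_apply, ← gkInvolution_inv, inv_inv,
        gkInvolution_gkInvolution]
    rw [heq, integral_comp_gkInvolution_inv μ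
      (fun c => (θ : GL (Fin n) F → ℂ) c⁻¹ * D (SchwartzBruhat.rightTranslate c σ)), hc]
  -- (4.17): the `[Λ₁ ⋆ σ]` exhaust `V`
  apply LinearMap.ext
  intro ξ
  obtain ⟨σ, rfl⟩ := hsurj ξ
  rw [hd, LinearMap.zero_apply]

/-- **Bump's (4.17)**: for a non-zero linear form `Λ` the vectors `[Λ ⋆ σ]`, `σ ∈ C_c^∞(G)`, fill
the irreducible `V` — they form a `G`-stable subspace by (4.10), non-zero by the bump-function
computation. [cite: Bump1997, (4.17), p. 459] -/
theorem gkVector_surjective {Λ : Module.Dual ℂ V} (hΛ : Λ ≠ 0) :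
    Function.Surjective (gkVector hB hBnd hadm μ Λ) := by
  let W : Subrepresentation π :=
    ⟨LinearMap.range (gkVector hB hBnd hadm μ Λ), fun g v hv => by
      obtain ⟨σ, rfl⟩ := hv
      exact ⟨_, (apply_gkVector hB hBnd hadm μ Λ g σ).symm⟩⟩
  -- a vector on which `Λ` does not vanish, and a bump function around its stabiliser
  obtain ⟨ξ, hξ⟩ : ∃ ξ, Λ ξ ≠ 0 := by
    by_contra h
    push Not at h
    exact hΛ (LinearMap.ext h)
  obtain ⟨K, hKo, hKc, hKξ⟩ := exists_isCompact_isOpen_le_stabilizer hadm.isSmooth ξ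
  have hne : gkVector hB hBnd hadm μ Λ ⟨_, indicator_mem_schwartzBruhat hKo hKc⟩ ≠ 0 := by
    rw [Ne, gkVector_eq_zero_iff]
    intro h0
    have := LinearMap.congr_fun h0 ξ
    rw [hadm.isSmooth.smear_indicator_apply μ Λ hKo hKc hKξ, LinearMap.zero_apply,
      mul_eq_zero] at this
    rcases this with h1 | h1
    · exact (measureReal_pos_of_isCompact_isOpen μ hKo hKc).ne' (by exact_mod_cast h1)
    · exact hξ h1
  have hW : W = ⊤ := (eq_bot_or_eq_top W).resolve_left fun h => hne (by
    have hmem : gkVector hB hBnd hadm μ Λ ⟨_, indicator_mem_schwartzBruhat hKo hKc⟩ ∈ W :=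
      ⟨_, rfl⟩
    rwa [h, Subrepresentation.mem_bot_iff] at hmem)
  exact LinearMap.range_eq_top.1 (congrArg Subrepresentation.toSubmodule hW)

end Distribution

/-! #### The theorem -/

section Main

/-- **Uniqueness of Whittaker functionals from the Gelfand–Kazhdan theorems** (the
Gelfand–Kazhdan criterion for `GL_n(F)`; Bump 1997, proof of Theorem 4.4.1, pp. 457–459,
"complete assuming Theorems 4.4.2 and 4.2.2"; Gelfand–Kazhdan 1975; Gelfand–Kazhdan 1972,
Theorems 1 and 3). Let `π` be an irreducible admissible representation of `GL_n(F)` on `V`.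
Assume

* `hA` (**Bump 1997, Theorem 4.4.2**; Gelfand–Kazhdan): every distribution `Δ` on `GL_n(F)`
  with `Δ(λ(u) φ) = ψ_U(u) Δ(φ)` and `Δ(ρ(u) φ) = ψ_U(u)⁻¹ Δ(φ)` for `u ∈ U_n` (Bump's (4.1),
  in the conventions (3.4)–(3.5) of p. 435) is stable under `ι(g) = w⁰ ᵗg w⁰`;
* `hB` (**Gelfand–Kazhdan 1972, Theorem 1** = Bump 1997, Theorem 4.2.2 (i)): there is a
  bilinear form `B` on `V`, non-degenerate in the second variable, with
  `B(π(g) ξ, π(ᵗg⁻¹) η) = B(ξ, η)`.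

Then the space of `ψ`-Whittaker functionals of `π` has dimension `≤ 1`: following Bump, two
Whittaker functionals `Λ₁ ≠ 0`, `Λ₂` give the `ι`-stable distribution
`Δ(φ) = Λ₂([Λ₁ ⋆ φ])` (`gkDistribution`, (4.13)), hence (Lemma 4.4.1,
`smear_eq_zero_of_smear_eq_zero`) a well-defined intertwining operator
`T [Λ₁ ⋆ φ] = [Λ₂ ⋆ φ]` on `V = {[Λ₁ ⋆ φ]}` ((4.17)–(4.18)), which is a scalar `c` by Schur's lemma
(`Representation.IsAdmissible.exists_eq_smul_id`), and `Λ₂ = c Λ₁` by the bump-function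
computation. Together with Jacquet's theorem (irreducible smooth representations of `GL_n(F)` are
admissible, the named fact `jacquetAdmissibility_gl`) and the two Gelfand–Kazhdan theorems this
is the named fact `rank_whittakerFunctionals_le_one` of `WhittakerModels`.
[cite: Bump1997, Theorem 4.4.1, pp. 457–459] [cite: GelfandKazhdan1972, Theorem 3] -/
theorem rank_whittakerFunctionals_le_one_of_gelfandKazhdan
    (π : Representation ℂ (GL (Fin n) F) V) (ψ : AddChar F Circle) [π.IsIrreducible]
    (hadm : π.IsAdmissible)
    (hA : ∀ Δ : Module.Dual ℂ (SchwartzBruhat (GL (Fin n) F)),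
      (∀ (u : ↥(upperUnitriangular (Fin n) F)) (φ : SchwartzBruhat (GL (Fin n) F)),
        Δ (SchwartzBruhat.leftTranslate (u : GL (Fin n) F) φ) = whittakerCharFun ψ u * Δ φ) →
      (∀ (u : ↥(upperUnitriangular (Fin n) F)) (φ : SchwartzBruhat (GL (Fin n) F)),
        Δ (SchwartzBruhat.rightTranslate (u : GL (Fin n) F) φ) = (whittakerCharFun ψ u)⁻¹ * Δ φ) →
      ∀ φ, Δ (SchwartzBruhat.compGKInvolution φ) = Δ φ)
    (hB : ∃ B : V →ₗ[ℂ] V →ₗ[ℂ] ℂ, (∀ η, (∀ ξ, B ξ η = 0) → η = 0) ∧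
      ∀ g ξ η, B (π g ξ) (π (glTransposeInv (Fin n) F g) η) = B ξ η) :
    Module.rank ℂ (whittakerFunctionals π ψ) ≤ 1 := by
  obtain ⟨B, hBnd, hBinv⟩ := hB
  -- a bi-invariant regular Haar measure on `GL_n(F)`
  borelize (GL (Fin n) F)
  set μ : Measure (GL (Fin n) F) := haarMeasure (Classical.arbitrary _) with hμ
  haveI : μ.IsMulRightInvariant := isMulRightInvariant_generalLinearGroup μ
  rw [rank_submodule_le_one_iff']
  by_cases hex : ∃ Λ₁ ∈ whittakerFunctionals π ψ, Λ₁ ≠ 0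
  swap
  · push Not at hex
    exact ⟨0, fun Λ hΛ => by rw [hex Λ hΛ]; exact Submodule.zero_mem _⟩
  obtain ⟨Λ₁, hΛ₁, hΛ₁0⟩ := hex
  refine ⟨Λ₁, fun Λ₂ hΛ₂ => ?_⟩
  -- the distribution `Δ = Λ₂([Λ₁ ⋆ ·])` is `ι`-stable by `hA`
  have hιΔ : ∀ φ, gkDistribution hBinv hBnd hadm μ Λ₁ Λ₂ (SchwartzBruhat.compGKInvolution φ) =
      gkDistribution hBinv hBnd hadm μ Λ₁ Λ₂ φ :=
    hA _ (gkDistribution_leftTranslate hBinv hBnd hadm μ ψ hΛ₁ Λ₂)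
      (gkDistribution_rightTranslate hBinv hBnd hadm μ ψ Λ₁ hΛ₂)
  have hsurj := gkVector_surjective hBinv hBnd hadm μ hΛ₁0
  set A₁ := gkVector hBinv hBnd hadm μ Λ₁ with hA₁
  set A₂ := gkVector hBinv hBnd hadm μ Λ₂ with hA₂
  -- Lemma 4.4.1: `ker A₁ ≤ ker A₂`
  have hker : LinearMap.ker A₁ ≤ LinearMap.ker A₂ := fun σ hσ => by
    rw [LinearMap.mem_ker] at hσ ⊢
    exact (gkVector_eq_zero_iff hBinv hBnd hadm μ Λ₂ σ).2
      (smear_eq_zero_of_smear_eq_zero hBinv hBnd hadm μ hιΔ hsurj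
        ((gkVector_eq_zero_iff hBinv hBnd hadm μ Λ₁ σ).1 hσ))
  -- the operator `T [Λ₁ ⋆ φ] = [Λ₂ ⋆ φ]` (4.18)
  obtain ⟨T, hT⟩ : ∃ T : V →ₗ[ℂ] V, ∀ σ, T (A₁ σ) = A₂ σ :=
    ⟨(LinearMap.ker A₁).liftQ A₂ hker ∘ₗ (A₁.quotKerEquivOfSurjective hsurj).symm.toLinearMap,
      fun σ => by
        rw [LinearMap.comp_apply, LinearEquiv.coe_toLinearMap,
          LinearMap.quotKerEquivOfSurjective_symm_apply, Submodule.liftQ_apply]⟩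
  -- `T` is an intertwining operator, by (4.10)
  have hTπ : ∀ g : GL (Fin n) F, T ∘ₗ π g = π g ∘ₗ T := fun g => by
    apply LinearMap.ext
    intro v
    obtain ⟨σ, rfl⟩ := hsurj v
    have e1 : π g (A₁ σ) = A₁ (SchwartzBruhat.rightTranslate (gkInvolution g⁻¹) σ) :=
      apply_gkVector hBinv hBnd hadm μ Λ₁ g σ
    have e2 : π g (A₂ σ) = A₂ (SchwartzBruhat.rightTranslate (gkInvolution g⁻¹) σ) :=
      apply_gkVector hBinv hBnd hadm μ Λ₂ g σ
    rw [LinearMap.comp_apply, LinearMap.comp_apply, e1, hT, hT, e2]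
  -- Schur's lemma
  obtain ⟨c, hc⟩ := hadm.exists_eq_smul_id (isOpen_glInt n F) (isCompact_glInt n F) T hTπ
  -- `Λ₂ = c Λ₁`, evaluating on bump functions
  refine Submodule.mem_span_singleton.2 ⟨c, LinearMap.ext fun ξ => ?_⟩
  obtain ⟨K, hKo, hKc, hKξ⟩ := exists_isCompact_isOpen_le_stabilizer hadm.isSmooth ξ
  set φ : SchwartzBruhat (GL (Fin n) F) := ⟨_, indicator_mem_schwartzBruhat hKo hKc⟩ with hφ
  have h2 : A₂ φ = c • A₁ φ := by rw [← hT, hc, LinearMap.smul_apply, LinearMap.id_apply]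
  have h3 : hadm.isSmooth.smear μ Λ₂ φ = c • hadm.isSmooth.smear μ Λ₁ φ := by
    rw [← gkDualMap_gkVector hBinv hBnd hadm μ Λ₂, ← gkDualMap_gkVector hBinv hBnd hadm μ Λ₁,
      ← map_smul, ← hA₁, ← hA₂, h2]
  have h4 := LinearMap.congr_fun h3 ξ
  rw [LinearMap.smul_apply, hadm.isSmooth.smear_indicator_apply μ Λ₂ hKo hKc hKξ,
    hadm.isSmooth.smear_indicator_apply μ Λ₁ hKo hKc hKξ, smul_eq_mul, mul_left_comm] at h4
  have hK0 : ((μ.real (K : Set (GL (Fin n) F)) : ℂ)) ≠ 0 := by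
    exact_mod_cast (measureReal_pos_of_isCompact_isOpen μ hKo hKc).ne'
  rw [LinearMap.smul_apply, smul_eq_mul]
  exact (mul_left_cancel₀ hK0 h4).symm

end Main

end GelfandKazhdanCriterion

section Jacquet

open GaloisRepresentations (glTransposeInv)

universe u

/-- **The named fact `rank_whittakerFunctionals_le_one` from the Gelfand–Kazhdan theorems and
Jacquet's admissibility theorem** (same-universe form). For `V` in the universe of `F`, the
vendored statement `rank_whittakerFunctionals_le_one π ψ` (irreducible *smooth* `π`;
Gelfand–Kazhdan 1975; Shalika 1974, Thm. 3.1) follows from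
`rank_whittakerFunctionals_le_one_of_gelfandKazhdan` once one has (i) Bump 1997, Thm. 4.4.2 for
the *non-trivial* character `ψ` (`hA`, guarded by `ψ.IsContinuousNontrivial` exactly as the named
fact is: for trivial `ψ` the `ι`-stability fails, e.g. `Δ(φ) = ∫_N φ(t n) dn`, `t = diag(a, b)`,
`a ≠ b`, `n = 2`), (ii) Gelfand–Kazhdan 1972, Thm. 1 = Bump 1997, Thm. 4.2.2 (i) for the
irreducible admissible `π` (`hB`, guarded by admissibility), and (iii) Jacquet's theorem that
irreducible smooth representations of `GL_n(F)` are admissible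
(`Literature.NumberTheory.Automorphic.JacquetAdmissibilityStatement`, the content of the named fact
`jacquetAdmissibility_gl`; Bernstein–Zelevinsky 1976, 3.25). This records the exact dependency
of the named fact on those three results; it is not its discharge. [cite: Bump1997, Theorem 4.4.1, p. 455] -/
theorem rank_whittakerFunctionals_le_one_of_gelfandKazhdan_of_jacquet {F : Type u} [Field F]
    [ValuativeRel F] [TopologicalSpace F] [IsNonarchimedeanLocalField F] {n : ℕ} {V : Type u}
    [AddCommGroup V] [Module ℂ V] (π : Representation ℂ (GL (Fin n) F) V) (ψ : AddChar F Circle)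
    (hJ : JacquetAdmissibilityStatement (GL (Fin n) F))
    (hA : ψ.IsContinuousNontrivial → ∀ Δ : Module.Dual ℂ (SchwartzBruhat (GL (Fin n) F)),
      (∀ (u : ↥(upperUnitriangular (Fin n) F)) (φ : SchwartzBruhat (GL (Fin n) F)),
        Δ (SchwartzBruhat.leftTranslate (u : GL (Fin n) F) φ) = whittakerCharFun ψ u * Δ φ) →
      (∀ (u : ↥(upperUnitriangular (Fin n) F)) (φ : SchwartzBruhat (GL (Fin n) F)),
        Δ (SchwartzBruhat.rightTranslate (u : GL (Fin n) F) φ) = (whittakerCharFun ψ u)⁻¹ * Δ φ) →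
      ∀ φ, Δ (SchwartzBruhat.compGKInvolution φ) = Δ φ)
    (hB : ∀ [π.IsIrreducible], π.IsAdmissible → ∃ B : V →ₗ[ℂ] V →ₗ[ℂ] ℂ,
      (∀ η, (∀ ξ, B ξ η = 0) → η = 0) ∧ ∀ g ξ η, B (π g ξ) (π (glTransposeInv (Fin n) F g) η) = B ξ η) :
    rank_whittakerFunctionals_le_one π ψ := by
  intro _ hπ hψ
  have hadm : π.IsAdmissible := hJ V π hπ inferInstance
  exact rank_whittakerFunctionals_le_one_of_gelfandKazhdan π ψ hadm (hA hψ) (hB hadm)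

end Jacquet

end Literature.NumberTheory.Automorphic
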